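import Summits.KontsevichZagierPeriods.KontsevichZagierPeriods.Theorems.LinRedNormalFormArrangementNormalFormStubRebaseSimpleZeroNestedTools

/-!
# Stub `stub_rebaseSimpleZeroTwo`, part `rebaseSimpleZero_nestedCommon` (crux `ArrangementNormalForm`,
line `janus-bands`) — brick `NestedGrid`

THICK clean nested pairs are good: if `B − A ≥ m₀ > 0` on the base cell of a clean nest
`A(y) < tᵢ < tⱼ < B(y)` with constant letters (`RebaseNest.IsNest`), an explicit rational grid of
mesh `h` with `|A'| h ≤ m₀` cuts the base cell (rule 1a, `IsNest.rowSplit`) into finitely many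
sub-intervals on each of which the pair is SEPARABLE by the constant `κ = A(g) + max(A', 0) h`
(`g` the left end of the sub-interval), hence good by `RebaseNest.nestSection`
(`IsNest.good_sep`). No compactness is used: the grid is explicit (`IsNest.good_grid`, induction
on the number of grid cells; the base cell is bounded by `IsNest.cell_bound`). Registered as
`rebaseSimpleZero_nestedThick`.

References: M. Kontsevich, D. Zagier, *Periods* (2001), §1.2, rules (1a), (2).
-/

noncomputable section

open Set MeasureTheory MvPolynomial
open Literature.NumberTheory.Transcendental Literature.ModelTheory.ExponentialFields

namespace Summit.KontsevichZagierPeriods.ArrangementNormalForm.JanusBands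

namespace RebaseNest

open SeparatePos RebasePos RebaseZero

variable {m' : ℕ} {s : KZ.IntegralRep (0 + 1 + 2)} {M : Fin m' → Cf} {i j : Fin 2} {A Bd : Cf} {T : BData}
  {p : MvPolynomial (Fin 0) ℚ} {a : Fin 2 → Option Cf}

/-- The separating constant on a short sub-interval: if `g < y < g + h`, `|α| h ≤ m₀ ≤ D`, then
`α y + a₂ ≤ α g + a₂ + max(α, 0) h ≤ α y + a₂ + D`. [folklore] -/
theorem sep_ineq {α a₂ m₀ h g y D : ℝ} (hy1 : g < y) (hy2 : y < g + h) (hm : |α| * h ≤ m₀) (hD : m₀ ≤ D) :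
    α * y + a₂ ≤ α * g + a₂ + max α 0 * h ∧ α * g + a₂ + max α 0 * h ≤ α * y + a₂ + D := by
  rcases le_or_gt 0 α with hα | hα
  · rw [max_eq_left hα]
    rw [abs_of_nonneg hα] at hm
    constructor <;> nlinarith
  · rw [max_eq_right hα.le]
    rw [abs_of_neg hα] at hm
    constructor <;> nlinarith

/-- A rational atom with non-zero slope is non-zero. [folklore] -/
theorem mk_ne_zero {α : ℚ} (hα : α ≠ 0) (β : ℚ) : RebaseZero.mk α β ≠ 0 := fun h0 => by
  have := congrArg (fun c : Cf => c.1 (Fin.last 0)) h0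
  simp only [mk_fst, Prod.fst_zero, Pi.zero_apply] at this
  exact hα this

/-- **One grid cell**: a thick clean nest over a base cell shorter than the mesh is separable,
hence good. -/
theorem IsNest.good_short (hN : IsNest s M i j A Bd T p a) (m₀ h g : ℚ) (hm : |A.1 (Fin.last 0)| * h ≤ m₀)
    (hc : ∀ y ∈ cell M, (m₀ : ℝ) ≤ ev Bd y - ev A y ∧ (g : ℝ) < y ∧ y < g + h) : Good 2 (KZ.of s) := by
  refine hN.good_sep (A.1 (Fin.last 0) * g + A.2 + max (A.1 (Fin.last 0)) 0 * h) fun y hy => ?_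
  obtain ⟨hD, h1, h2⟩ := hc y hy
  have hm' : |(A.1 (Fin.last 0) : ℝ)| * h ≤ m₀ := by exact_mod_cast hm
  have key := sep_ineq (a₂ := (A.2 : ℝ)) h1 h2 hm' hD
  have hev : ev Bd y = ev A y + (ev Bd y - ev A y) := by ring
  rw [hev]
  simp only [ev] at key ⊢
  push_cast
  exact key

/-- **The grid** (induction on the number `n` of cells of mesh `h`): a thick clean nest whose base
cell lies in `(g, g + n h)` is good — cut at `g + h` (rule 1a); the left piece is one grid cell
(`IsNest.good_short`), the right piece has `n − 1` cells. -/
theorem IsNest.good_grid (n : ℕ) : ∀ {m' : ℕ} {M : Fin m' → Cf} {s : KZ.IntegralRep (0 + 1 + 2)} (g : ℚ),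
    IsNest s M i j A Bd T p a → ∀ m₀ h : ℚ, 0 < h → |A.1 (Fin.last 0)| * h ≤ m₀ →
    (∀ y ∈ cell M, (m₀ : ℝ) ≤ ev Bd y - ev A y ∧ (g : ℝ) < y ∧ y < g + n * h) → Good 2 (KZ.of s) := by
  induction n with
  | zero =>
    intro m' M s g hN m₀ h _ _ hc
    exact hN.good_cell_empty fun y hy => by
      obtain ⟨-, h1, h2⟩ := hc y hy
      push_cast at h2
      linarith
  | succ n ih =>
    intro m' M s g hN m₀ h hh hm hc
    refine hN.rowSplit (RebaseZero.mk (-1) (g + h)) (mk_ne_zero (by norm_num) _) (fun s₁ h₁ => ?_)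
      (fun s₂ h₂ => ?_)
    · refine h₁.good_short m₀ h g hm fun y hy => ?_
      rw [mem_cell_snoc] at hy
      obtain ⟨hy, hq⟩ := hy
      obtain ⟨hD, h1, -⟩ := hc y hy
      rw [ev_mk] at hq
      push_cast at hq
      exact ⟨hD, h1, by linarith⟩
    · refine ih (g + h) h₂ m₀ h hh hm fun y hy => ?_
      rw [mem_cell_snoc] at hy
      obtain ⟨hy, hq⟩ := hy
      obtain ⟨hD, -, h2⟩ := hc y hy
      rw [ev_neg, ev_mk] at hq
      push_cast at hq h2 ⊢
      exact ⟨hD, by linarith, by linarith⟩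

/-- **Thick clean nests are good**: if `B − A ≥ m₀ > 0` on the base cell, an explicit rational grid
of mesh `h = m₀/(|A'| + 1)` over `(−R', R') ⊇ cell` dissects the pair into separable pieces. -/
theorem IsNest.good_thick (hN : IsNest s M i j A Bd T p a) (m₀ : ℚ) (hm₀ : 0 < m₀)
    (hD : ∀ y ∈ cell M, (m₀ : ℝ) ≤ ev Bd y - ev A y) : Good 2 (KZ.of s) := by
  -- the base cell is bounded
  obtain ⟨R, hR⟩ := hN.cell_bound fun y hy => by
    have h0 : (0 : ℝ) < m₀ := by exact_mod_cast hm₀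
    linarith [hD y hy]
  obtain ⟨R', hR'⟩ := exists_rat_gt R
  -- the mesh
  set α : ℚ := A.1 (Fin.last 0) with hα
  set h : ℚ := m₀ / (|α| + 1) with hh
  have hpos : 0 < |α| + 1 := by positivity
  have hh0 : 0 < h := div_pos hm₀ hpos
  have hm : |α| * h ≤ m₀ := by
    rw [hh, mul_div_assoc']
    rw [div_le_iff₀ hpos]
    nlinarith [abs_nonneg α]
  -- the number of cells
  obtain ⟨N, hN'⟩ := exists_nat_gt (2 * R' / h)
  have hNh : 2 * R' < N * h := by rwa [div_lt_iff₀ hh0] at hN'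
  refine hN.rowSplit (RebaseZero.mk 1 R') (mk_ne_zero one_ne_zero _) (fun s₁ h₁ => ?_) (fun s₂ h₂ => ?_)
  · refine h₁.good_grid N (-R') m₀ h hh0 hm fun y hy => ?_
    rw [mem_cell_snoc] at hy
    obtain ⟨hy, hq⟩ := hy
    rw [ev_mk] at hq
    have hyR := (le_abs_self y).trans (hR y hy)
    have hNh' : (2 * R' : ℝ) < N * h := by exact_mod_cast hNh
    push_cast at hq ⊢
    exact ⟨hD y hy, by linarith, by linarith⟩
  · refine h₂.good_cell_empty fun y hy => ?_
    rw [mem_cell_snoc] at hy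
    obtain ⟨hy, hq⟩ := hy
    rw [ev_neg, ev_mk] at hq
    have hyR : -R ≤ y := by linarith [neg_abs_le y, hR y hy]
    push_cast at hq
    linarith

end RebaseNest

/-- Registered support goal of this file (part of `rebaseSimpleZero_nestedCommon`): thick clean
nested pairs over a one-dimensional base are good (`RebaseNest.IsNest.good_thick`). -/
theorem rebaseSimpleZero_nestedThick (m' : ℕ) (s : KZ.IntegralRep (0 + 1 + 2)) (M : Fin m' → (Fin (0 + 1) → ℚ) × ℚ) (i j : Fin 2) (A Bd : (Fin (0 + 1) → ℚ) × ℚ) (T : RebaseZero.BData) (p : MvPolynomial (Fin 0) ℚ) (a : Fin 2 → Option ((Fin (0 + 1) → ℚ) × ℚ)) (hN : RebaseNest.IsNest s M i j A Bd T p a) (m₀ : ℚ) (hm₀ : 0 < m₀) (hD : ∀ y ∈ RebaseZero.cell M, (m₀ : ℝ) ≤ RebaseZero.ev Bd y - RebaseZero.ev A y) : RebaseZero.Good 2 (KZ.of s) :=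
  hN.good_thick m₀ hm₀ hD

end Summit.KontsevichZagierPeriods.ArrangementNormalForm.JanusBands
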